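import Summits.MatrixMultiplication.MatrixMultiplication.Theses.EPRFaces
import Summits.MatrixMultiplication.MatrixMultiplication.Theses.LongBlockAmortisation
import Summits.MatrixMultiplication.MatrixMultiplication.Theorems.EPRFacesFaceMaximiserNormalForm
import Summits.MatrixMultiplication.MatrixMultiplication.Theorems.ShapeSubmodularityPerfectAmortisation

/-!
# Crux `FaceMaximiser` (B, stmt-MatrixMultiplication-10894) is the summit — unconditionally

Helper file (`--supports stmt-MatrixMultiplication-10894`) of the line `registered`
(`Cruxes/FaceMaximiser/Lines/birth.lean`, lead c1).  B in rank form: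
`∀ k ≥ 1, ∀ β, R(⟨n,n,n^k⟩) = O(n^β) → ω + (k − 1) ≤ β` (`R` = tensor rank of
`matMulTensor ℂ n n (n^k)`, `ω = omega ℂ`).

Two facts already in the tree are composed here, nothing else:

* `EPRFacesFaceMaximiser.faceMaximiser_iff_matrixMultiplication (hE : PerfectAmortisation) :
  FaceMaximiser ↔ MatrixMultiplication` (`Theorems/EPRFacesFaceMaximiserNormalForm.lean`, p149667):
  modulo E = perfect amortisation, B is the summit (`→` is the route's deciding theorem
  `EPRFaces.closes`, `←` the flattening bound, `converse_proof`);
* `PerfectAmortisation.perfectAmortisation_proof : EPRFaces.PerfectAmortisation`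
  (`Theorems/ShapeSubmodularityPerfectAmortisation.lean`, p149012, crux stmt-10893 CLOSED
  2026-08-17): E is now a theorem of the tree (Coppersmith 1982 / first-power `CW_q` laser method,
  `q = k + 2 → ∞`).

Hence, with no hypothesis left:

* `faceMaximiser_iff_summit : FaceMaximiser ↔ MatrixMultiplication` and
  `faceMaximiser_iff_omega_two : FaceMaximiser ↔ omega ℂ = 2` — **the crux B is literally
  equivalent to the summit statement `ω(ℂ) = 2`**;
* `faceAtTwo_iff_summit` / `faceAtTwo_iff_omega_two` — the same for the line's one open stub
  `stub_faceAtTwo` (B at `k = 2`: every `β` with `R(⟨n,n,n²⟩) = O(n^β)` has `ω + 1 ≤ β`), via the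
  landed normal form `faceMaximiser_iff_faceAtTwo`: **the registered stub is the summit**;
* `omegaRect_two_eq_iff_summit : ω(1,1,2) = ω + 1 ↔ MatrixMultiplication` — the one-equation form;
* `longBlockAmortisation_faceMaximiser_iff_summit` — the sharing route's copy of the decl
  (route-MatrixMultiplication-LongBlockAmortisation; same term);
* `eprFaces_thesis_iff_summit : EPRFaces.Thesis ↔ MatrixMultiplication` and
  `eprFaces_thesis_iff_faceMaximiser` — the route's target (stmt-10892, `Thesis = B ∧ E`) has
  contracted to B, i.e. to the summit.

Reading: a proof of B (or of its `k = 2` instance) is a proof of `ω(ℂ) = 2` and a refutation of B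
is a proof of `ω(ℂ) > 2`; route `EPRFaces` has delivered E, `Converse`, `Dichotomy`,
`SpectralFaceForm`, the convexity lift and this normal form, and what remains of it is the summit
itself under the name B.  No line of stubs strictly weaker than the summit can close B.
-/

-- `Summit.MatrixMultiplication.MatrixMultiplication.…` repeats a component by design (single-conjunct summit)
set_option linter.dupNamespace false

namespace Summit.MatrixMultiplication.MatrixMultiplication.Theorems

open Filter Asymptotics
open Literature.Computability.AlgebraicComplexity
open Summit.MatrixMultiplication.MatrixMultiplication.Theses.EPRFaces
-- E = perfect amortisation, PROVED (crux stmt-10893, `Theorems/ShapeSubmodularityPerfectAmortisation.lean`, p149012)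
open Summit.MatrixMultiplication.MatrixMultiplication.Theorems.PerfectAmortisation (perfectAmortisation_proof)

namespace EPRFacesFaceMaximiser

/-- **B ↔ summit, unconditionally**: the crux `FaceMaximiser` (no asymptotic economy of
`⟨n,n,n^k⟩` over `n^{k−1}` square products, all `k ≥ 1`) holds if and only if `ω(ℂ) = 2`
(`MatrixMultiplication`).  `→`: `EPRFaces.closes` with E discharged by the landed `perfectAmortisation_proof`;
`←`: the flattening bound `R(⟨n,n,n^k⟩) ≥ n^{k+1}` (`converse_proof`). -/
theorem faceMaximiser_iff_summit : FaceMaximiser ↔ _root_.MatrixMultiplication :=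
  faceMaximiser_iff_matrixMultiplication perfectAmortisation_proof

/-- **B ↔ ω(ℂ) = 2**, read on the exponent itself. -/
theorem faceMaximiser_iff_omega_two : FaceMaximiser ↔ omega ℂ = 2 :=
  faceMaximiser_iff_omega_eq_two perfectAmortisation_proof

/-- **The line's open stub is the summit**: the registered stub statement `stub_faceAtTwo` of line
`registered` (B at `k = 2`: every `β` with `R(⟨n,n,n²⟩) = O(n^β)` satisfies `ω + 1 ≤ β`) holds if
and only if `ω(ℂ) = 2` — by the landed normal form `faceMaximiser_iff_faceAtTwo` (B ↔ B at `k = 2`,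
Lotti–Romani convexity) and `faceMaximiser_iff_summit`. -/
theorem faceAtTwo_iff_summit : (∀ β : ℝ, ((fun n : ℕ => (tensorRank (matMulTensor ℂ n n (n ^ 2)) : ℝ)) =O[atTop] fun n : ℕ => (n : ℝ) ^ β) → omega ℂ + 1 ≤ β) ↔ _root_.MatrixMultiplication :=
  faceMaximiser_iff_faceAtTwo.symm.trans faceMaximiser_iff_summit

/-- The stub statement read on the exponent: (B at `k = 2`) ↔ `ω(ℂ) = 2`. -/
theorem faceAtTwo_iff_omega_two : (∀ β : ℝ, ((fun n : ℕ => (tensorRank (matMulTensor ℂ n n (n ^ 2)) : ℝ)) =O[atTop] fun n : ℕ => (n : ℝ) ^ β) → omega ℂ + 1 ≤ β) ↔ omega ℂ = 2 :=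
  faceMaximiser_iff_faceAtTwo.symm.trans faceMaximiser_iff_omega_two

/-- **One equation**: `ω(1,1,2) = ω + 1 ↔ ω(ℂ) = 2` — multiplying an `n × n` matrix by an `n × n²`
matrix is asymptotically as expensive as `n` square products exactly when `ω = 2`
(`→`: B then E; `←`: both sides equal `3` by flattening and blocking). -/
theorem omegaRect_two_eq_iff_summit : omegaRect ℂ 1 1 2 = omega ℂ + 1 ↔ _root_.MatrixMultiplication :=
  faceMaximiser_iff_omegaRect_two.symm.trans faceMaximiser_iff_summit

/-- The same equation against `ω(ℂ) = 2` verbatim. -/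
theorem omegaRect_two_eq_iff_omega_two : omegaRect ℂ 1 1 2 = omega ℂ + 1 ↔ omega ℂ = 2 :=
  faceMaximiser_iff_omegaRect_two.symm.trans faceMaximiser_iff_omega_two

/-- **The sharing route's copy of the crux is the summit too**: route
`LongBlockAmortisation` files `FaceMaximiser` as the same term (stmt-10894 is shared verbatim), so
its decl is equivalent to `MatrixMultiplication` by the same proof (definitional unfolding). -/
theorem longBlockAmortisation_faceMaximiser_iff_summit : Summit.MatrixMultiplication.MatrixMultiplication.Theses.LongBlockAmortisation.FaceMaximiser ↔ _root_.MatrixMultiplication :=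
  faceMaximiser_iff_summit

/-- **The route target has contracted to B**: with E proved, `EPRFaces.Thesis` (stmt-10892,
literally `B ∧ E` in rank form) is equivalent to B alone. -/
theorem eprFaces_thesis_iff_faceMaximiser : Thesis ↔ FaceMaximiser :=
  ⟨fun h => h.1, fun hB => ⟨hB, perfectAmortisation_proof⟩⟩

/-- **… and hence to the summit**: `EPRFaces.Thesis ↔ MatrixMultiplication` (`→` is the route's
assembly `closes`, `←` is `converse_proof`; both now unconditional). -/
theorem eprFaces_thesis_iff_summit : Thesis ↔ _root_.MatrixMultiplication :=
  eprFaces_thesis_iff_faceMaximiser.trans faceMaximiser_iff_summit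

end EPRFacesFaceMaximiser

end Summit.MatrixMultiplication.MatrixMultiplication.Theorems
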